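/-
Copyright: b2b-lace packet (literature seat, gen 13).  [NoBLE17-I] §5.3.2 (5.40)–(5.42): the MULTIPLICITY TABLE
of the repulsive bubble / triangle / square extraction bounds in CLOSED FORM — every junction-position index set of
the tree modules `RepulsiveBubbleExtraction` / `RepulsiveTriangleExtraction` / `RepulsiveSquareExtraction` counted as
a binomial coefficient (kernel), compared term by term with the printed coefficients, and (5.41)/(5.42) restated
with binomial coefficients.  Proof-only module: no definition, no named fact.
-/
import Literature.Probability.FitznerVanDerHofstad2017.RepulsiveSquareExtraction
import HarnessLib

/-!
# [NoBLE17] (5.40)–(5.42): the multiplicities of the repulsive-polygon extraction bounds, counted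

[NoBLE17-I] §5.3.2 (PTRF 169 (2017) p. 1098; TeX `NoBLEAnalysis_rev_fin.tex` l.3136–3175) bounds the repulsive bubble,
triangle and square `𝓑_{m₁,m₂}(x)`, `𝓣_{m₁,m₂,m₃}(x)`, `𝓢_{m₁,m₂,m₃,m₄}(x)` by extracting the explicit contributions
of total length `i < M` ("we fix an `M ∈ ℕ` … and use (5.39)") and majorising the remaining lines by two-point
functions; every term carries a MULTIPLICITY, the number of admissible positions of the junctions.  The tree modules
type each multiplicity as the cardinality of an explicit finite set of junction positions; this module COUNTS those
sets.  Writing `m` for the total extracted length (`m_{1,2}`, `m_{1,3}`, `m_{1,4}`) and `n = M − m`: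

| term | index set (tree) | count (kernel, this module) | printed coefficient, [NoBLE17-I] p. 1098 |
|---|---|---|---|
| bubble, explicit `a_i` | `Icc m₁ (i−m₂)` | `i+1−m` (`card_Icc_sub_eq`, bubble module) | `(i+1−m_{1,2})` — equal |
| bubble, one tail | `Ico m₁ (M−m₂)` | `M−m` (`card_Ico_sub_eq`, bubble module) | `(M−m_{1,2})` — equal |
| triangle, explicit | `triPairsE i` | `C(i+2−m,2)` (`card_triPairsE_eq_choose`) | `Σ_{s₁}Σ_{s₂}1 = ½(i+1−m_{1,3})(i+2−m_{1,3})` — equal |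
| triangle, one tail | `triPairsO M` | `C(M+1−m,2)` (`card_triPairsO_eq_choose`, triangle module) | first form `Σ_{s=m₁}^{M−m_{2,3}−1}(M−m_{2,3}−s)` — equal; the closed form printed after "=", `½(M−m_{1,3})(M−1−m_{1,3}) = C(n,2)`, is smaller by `n` (`choose_succ_two_three`) |
| triangle, two tails | `Ico m₁ (M−m₂−m₃)` | `M−m` (`card_triTwoTail_eq`) | `(M−m_{1,3})` — equal |
| square, explicit | `sqTriplesE i` | `C(i+3−m,3)` (`card_sqTriplesE_eq_choose`) | `(1/6)∏_{s=1}^{3}(i−m_{1,4}+s)` — equal (`six_mul_card_sqTriplesE_eq_prod`) |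
| square, one tail | `sqTriplesO M` | `C(M+2−m,3)` (`card_sqTriplesO_eq_choose`) | `(1/6)∏_{s=1}^{3}(M−m_{1,4}+s) = C(n+3,3)` — LARGER by `C(n+2,2)` (`choose_succ_two_three`): an over-count, the printed term is a valid bound (`card_sqTriplesO_le_printed`) |
| square, two tails | `triPairsO m₁ m₂ m₃ (M−m₄)` | `C(M+1−m,2)` (`card_sqTwoTail_eq_choose`) | `½(M−m_{1,4})(M−1−m_{1,4}) = C(n,2)` — smaller by `n` |
| square, three tails | `Ico m₁ (M−m₂−m₃−m₄)` | `M−m` (`card_sqThreeTail_eq`) | `(M−m_{1,4})` — equal |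
| all lines tails | `1` | `1` | `1` — equal |

Consequences typed here: (5.41) and (5.42) with every multiplicity a binomial coefficient
(`sum_sum_diagT_le_extraction_choose`, `sum3_diagS_le_extraction_choose`), and (5.42) IN THE PRINTED SHAPE with the
single correction that the derivation forces — the two-tail coefficient `½(M−m)(M+1−m)` in place of the printed
`½(M−m)(M−1−m)`, the printed (larger) one-tail coefficient `(1/6)∏_{s=1}^{3}(M−m+s)` being kept
(`sum3_diagS_le_extraction_printedShape`).  The two "smaller by `n`" entries are the arithmetic slip recorded in the
packet as HOME DIVERGENCE D27 (a)/(b) / D57 and REFEREE R-D57 (the verification notebook `Percolation.nb`, cells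
`Bound[Triangle|Square,m,s]`, codes the printed closed forms at its own cut — D27 CORRECTION: justified there by
lattice parity, `LatticeWordParity`); nothing here asserts that the printed displays are false as inequalities — only
that the extraction argument printed on p. 1098 yields the counts in column 3, which for those two entries exceed the
printed closed forms.

## References
* [NoBLE17] R. Fitzner, R. van der Hofstad, Generalized approach to the non-backtracking lace expansion,
  Probab. Theory Relat. Fields 169 (2017) 1041–1119, doi:10.1007/s00440-016-0747-8 — §5.3.2 "Repulsive diagrams",
  (5.40)–(5.42), p. 1098.
* [FvdH17] R. Fitzner, R. van der Hofstad, Mean-field behavior for nearest-neighbor percolation in `d > 10`,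
  Electron. J. Probab. 22 (2017) no. 43; arXiv:1506.07977v2 — §4.2 (4.18) and the display after it (the repulsive
  diagrams of percolation are bounded "in the same manner").
-/

noncomputable section

namespace Literature.Probability.FitznerVanDerHofstad2017

open _root_.MeasureTheory Literature.Probability.Percolation
open Literature.Probability.LatticeModels
open scoped BigOperators ENNReal

variable {d : ℕ}

/-! ### A. Two binomial sums -/

/-- Reflected hockey stick at `2`: `Σ_{s ∈ [a, N]} C(N + 2 − s, 2) = C(N + 3 − a, 3)` (Zhu Shijie / Pascal;
`0 = 0` when `a > N`). [folklore] -/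
theorem sum_Icc_choose_two_reflect (a N : ℕ) :
    ∑ s ∈ Finset.Icc a N, (N + 2 - s).choose 2 = (N + 3 - a).choose 3 := by
  rcases Nat.lt_or_ge N a with h | h
  · rw [Finset.Icc_eq_empty_of_lt h, Finset.sum_empty, Nat.choose_eq_zero_of_lt (by omega)]
  · rw [← Finset.Ico_add_one_right_eq_Icc,
      Finset.sum_Ico_reflect (fun j => j.choose 2) a (show N + 1 ≤ N + 2 + 1 by omega),
      show N + 2 + 1 - (N + 1) = 2 by omega, show N + 2 + 1 - a = (N + 2 - a) + 1 by omega,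
      Finset.Ico_add_one_right_eq_Icc, Nat.sum_Icc_choose]

/-- `Σ_{s ∈ [a, M)} C(K − s, 2) = C(K + 1 − a, 3)` whenever `K ≤ M + 1` (the terms with `s ≥ K − 1` vanish, the
rest is `sum_Icc_choose_two_reflect`). [folklore] -/
theorem sum_Ico_choose_two_of_le (a K : ℕ) : ∀ M : ℕ, K ≤ M + 1 →
    ∑ s ∈ Finset.Ico a M, (K - s).choose 2 = (K + 1 - a).choose 3
  | 0 => fun h => by
    rw [Finset.Ico_eq_empty_of_le (Nat.zero_le _), Finset.sum_empty, Nat.choose_eq_zero_of_lt (by omega)]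
  | M + 1 => fun h => by
    rcases Nat.lt_or_ge M a with haM | haM
    · rw [Finset.Ico_eq_empty_of_le (by omega), Finset.sum_empty, Nat.choose_eq_zero_of_lt (by omega)]
    · rcases Nat.lt_or_ge K (M + 2) with hK | hK
      · rw [Finset.sum_Ico_succ_top haM, sum_Ico_choose_two_of_le a K M (by omega),
          Nat.choose_eq_zero_of_lt (show K - M < 2 by omega), add_zero]
      · obtain rfl : K = M + 2 := le_antisymm h hK
        rw [Finset.Ico_add_one_right_eq_Icc, sum_Icc_choose_two_reflect]

/-- Pascal at `2` and at `3`: `C(n+1, 2) = C(n, 2) + n` and `C(n+3, 3) = C(n+2, 3) + C(n+2, 2)` — the one-tail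
triangle / two-tail square count `C(n+1,2)` exceeds the closed form `½n(n−1) = C(n,2)` printed after "=" in
[NoBLE17-I] (5.41)/(5.42) by `n = M − m`, and the printed one-tail square coefficient `(1/6)∏_{s=1}^{3}(n+s) = C(n+3,3)`
exceeds the count `C(n+2,3)` by `C(n+2,2)`. [cite: FitznerVanDerHofstad2016NoBLE, §5.3.2 (5.41)–(5.42) PTRF p. 1098] -/
theorem choose_succ_two_three (n : ℕ) :
    (n + 1).choose 2 = n.choose 2 + n ∧ (n + 3).choose 3 = (n + 2).choose 3 + (n + 2).choose 2 := by
  refine ⟨?_, ?_⟩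
  · have h := Nat.choose_succ_succ' n 1
    rw [Nat.choose_one_right] at h
    rw [Nat.add_comm (n.choose 2)]
    exact h
  · rw [Nat.add_comm ((n + 2).choose 3)]
    exact Nat.choose_succ_succ' (n + 2) 2

/-- The printed product forms of the triangle and square coefficients: `½(n+1)(n+2) = C(n+2, 2)` and
`(1/6)∏_{s=1}^{3}(n+s) = C(n+3, 3)`, i.e. `2·C(n+2,2) = (n+1)(n+2)` and `6·C(n+3,3) = (n+1)(n+2)(n+3)`.
[cite: FitznerVanDerHofstad2016NoBLE, §5.3.2 (5.41)–(5.42) PTRF p. 1098] -/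
theorem mul_choose_two_three_eq_prod (n : ℕ) :
    2 * (n + 2).choose 2 = (n + 1) * (n + 2) ∧ 6 * (n + 3).choose 3 = (n + 1) * (n + 2) * (n + 3) := by
  refine ⟨?_, ?_⟩
  · have h := Nat.descFactorial_eq_factorial_mul_choose (n + 2) 2
    rw [show Nat.factorial 2 = 2 from rfl] at h
    rw [← h, Nat.descFactorial_succ, Nat.descFactorial_succ, Nat.descFactorial_zero,
      show n + 2 - 1 = n + 1 by omega, show n + 2 - 0 = n + 2 by omega]
    ring
  · have h := Nat.descFactorial_eq_factorial_mul_choose (n + 3) 3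
    rw [show Nat.factorial 3 = 6 from rfl] at h
    rw [← h, Nat.descFactorial_succ, Nat.descFactorial_succ, Nat.descFactorial_succ, Nat.descFactorial_zero,
      show n + 3 - 2 = n + 1 by omega, show n + 3 - 1 = n + 2 by omega, show n + 3 - 0 = n + 3 by omega]
    ring

/-! ### B. The triangle multiplicities in closed form -/

/-- **Triangle, explicit term**: `#triPairsE(L) = C(L + 2 − m_{1,3}, 2) = ½(L+1−m_{1,3})(L+2−m_{1,3})` for
`m_{1,3} ≤ L` — the printed coefficient `Σ_{s₁=m₁}^{L−m_{2,3}} Σ_{s₂=m₂}^{L−m₃−s₁} 1 = ½(L+1−m_{1,3})(L+2−m_{1,3})`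
of `a_L(x) μ̄^L` in (5.41), now in closed form. [cite: FitznerVanDerHofstad2016NoBLE, §5.3.2 (5.41) PTRF p. 1098] -/
theorem card_triPairsE_eq_choose {m₁ m₂ m₃ L : ℕ} (h : m₁ + m₂ + m₃ ≤ L) :
    (triPairsE m₁ m₂ m₃ L).card = (L + 2 - (m₁ + m₂ + m₃)).choose 2 := by
  rw [card_triPairsE, ← Finset.Ico_add_one_right_eq_Icc,
    show ∑ s ∈ Finset.Ico m₁ (L - (m₂ + m₃) + 1), (L - m₃ + 1 - (s + m₂)) =
      ∑ s ∈ Finset.Ico m₁ (L - (m₂ + m₃) + 1), (L - (m₂ + m₃) + 1 - s) from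
      Finset.sum_congr rfl fun s _ => by omega,
    sum_Ico_tsub_eq_choose]
  (congr 1; omega)

/-- The same in the PRINTED product form: `2·#triPairsE(L) = (L+1−m_{1,3})(L+2−m_{1,3})`, i.e. the coefficient of
`a_L(x) μ̄^L` in (5.41) is `½(L+1−m_{1,3})(L+2−m_{1,3})` exactly as printed.
[cite: FitznerVanDerHofstad2016NoBLE, §5.3.2 (5.41) PTRF p. 1098] -/
theorem two_mul_card_triPairsE_eq_prod {m₁ m₂ m₃ L : ℕ} (h : m₁ + m₂ + m₃ ≤ L) :
    2 * (triPairsE m₁ m₂ m₃ L).card = (L + 1 - (m₁ + m₂ + m₃)) * (L + 2 - (m₁ + m₂ + m₃)) := by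
  rw [card_triPairsE_eq_choose h, show L + 2 - (m₁ + m₂ + m₃) = (L - (m₁ + m₂ + m₃)) + 2 by omega,
    show L + 1 - (m₁ + m₂ + m₃) = (L - (m₁ + m₂ + m₃)) + 1 by omega]
  exact (mul_choose_two_three_eq_prod _).1

/-- **Triangle, two-tail term**: `#Ico m₁ (M − m₂ − m₃) = M − m_{1,3}` — the printed coefficient `(M−m_{1,3})` of
`(2dμ̄)^M (D^{⋆M}⋆G^{⋆2})(x)` in (5.41). [cite: FitznerVanDerHofstad2016NoBLE, §5.3.2 (5.41) PTRF p. 1098] -/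
theorem card_triTwoTail_eq (m₁ m₂ m₃ M : ℕ) :
    (Finset.Ico m₁ (M - (m₂ + m₃))).card = M - (m₁ + m₂ + m₃) := by
  rw [Nat.card_Ico]
  omega

/-- The one-tail triangle count against the closed form printed after "=" in (5.41):
`#triPairsO = C(M−m_{1,3}, 2) + (M − m_{1,3})` (printed: `½(M−m_{1,3})(M−1−m_{1,3}) = C(M−m_{1,3},2)`; truncated
subtraction, every `m₁, m₂, m₃, M`).
[cite: FitznerVanDerHofstad2016NoBLE, §5.3.2 (5.41) PTRF p. 1098] -/
theorem card_triPairsO_eq_printed_add (m₁ m₂ m₃ M : ℕ) :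
    (triPairsO m₁ m₂ m₃ M).card = (M - (m₁ + m₂ + m₃)).choose 2 + (M - (m₁ + m₂ + m₃)) := by
  rw [card_triPairsO_eq_choose]
  rcases Nat.lt_or_ge M (m₁ + m₂ + m₃) with h | h
  · have h1 : (M + 1 - (m₁ + m₂ + m₃)).choose 2 = 0 := Nat.choose_eq_zero_of_lt (by omega)
    have h2 : (M - (m₁ + m₂ + m₃)).choose 2 = 0 := Nat.choose_eq_zero_of_lt (by omega)
    rw [h1, h2]
    omega
  · rw [show M + 1 - (m₁ + m₂ + m₃) = (M - (m₁ + m₂ + m₃)) + 1 by omega, (choose_succ_two_three _).1]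

/-- The one-tail triangle count in the PRINTED product form: `2·#triPairsO(M) = (M−m_{1,3})(M+1−m_{1,3})`
(truncated subtraction) — the value of the first printed form `Σ_{s=m₁}^{M−m_{2,3}−1}(M−m_{2,3}−s)`; the display prints
`½(M−m_{1,3})(M−1−m_{1,3})` after "=". [cite: FitznerVanDerHofstad2016NoBLE, §5.3.2 (5.41) PTRF p. 1098] -/
theorem two_mul_card_triPairsO_eq_prod (m₁ m₂ m₃ M : ℕ) :
    2 * (triPairsO m₁ m₂ m₃ M).card = (M - (m₁ + m₂ + m₃)) * (M + 1 - (m₁ + m₂ + m₃)) := by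
  rcases Nat.lt_or_ge (m₁ + m₂ + m₃) M with h' | h'
  · obtain ⟨n, rfl⟩ : ∃ n, M = m₁ + m₂ + m₃ + 1 + n := ⟨M - (m₁ + m₂ + m₃) - 1, by omega⟩
    rw [card_triPairsO_eq_choose, show m₁ + m₂ + m₃ + 1 + n + 1 - (m₁ + m₂ + m₃) = n + 2 by omega,
      show m₁ + m₂ + m₃ + 1 + n - (m₁ + m₂ + m₃) = n + 1 by omega]
    exact (mul_choose_two_three_eq_prod n).1
  · rw [card_triPairsO_eq_choose, Nat.choose_eq_zero_of_lt (by omega), show M - (m₁ + m₂ + m₃) = 0 by omega]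
    simp

/-! ### C. The square multiplicities in closed form -/

/-- **Square, explicit term**: `#sqTriplesE(L) = C(L + 3 − m_{1,4}, 3)` for `m_{1,4} ≤ L` — the printed coefficient
`(1/6)∏_{s=1}^{3}(L−m_{1,4}+s)` of `a_L(x) μ̄^L` in (5.42) (`six_mul_card_sqTriplesE_eq_prod`).  Proof: the fibre of
`sqTriplesE` over the first junction `r₁ = a` is `{a} × triPairsE (a+m₂) m₃ m₄ L`.
[cite: FitznerVanDerHofstad2016NoBLE, §5.3.2 (5.42) PTRF p. 1098] -/
theorem card_sqTriplesE_eq_choose {m₁ m₂ m₃ m₄ L : ℕ} (h : m₁ + m₂ + m₃ + m₄ ≤ L) :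
    (sqTriplesE m₁ m₂ m₃ m₄ L).card = (L + 3 - (m₁ + m₂ + m₃ + m₄)).choose 3 := by
  classical
  have hmaps : ((sqTriplesE m₁ m₂ m₃ m₄ L : Finset (ℕ × ℕ × ℕ)) : Set (ℕ × ℕ × ℕ)).MapsTo
      (fun r : ℕ × ℕ × ℕ => r.1) (Finset.Icc m₁ (L - (m₂ + m₃ + m₄)) : Finset ℕ) := by
    intro r hr
    have hr' : r ∈ sqTriplesE m₁ m₂ m₃ m₄ L := by simpa using hr
    simp only [sqTriplesE, Finset.mem_filter, Finset.mem_product] at hr'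
    simpa using hr'.1.1
  rw [Finset.card_eq_sum_card_fiberwise hmaps]
  have hfib : ∀ a ∈ Finset.Icc m₁ (L - (m₂ + m₃ + m₄)),
      ((sqTriplesE m₁ m₂ m₃ m₄ L).filter fun r : ℕ × ℕ × ℕ => r.1 = a).card =
        (L - (m₂ + m₃ + m₄) + 2 - a).choose 2 := by
    intro a ha
    rw [Finset.mem_Icc] at ha
    have hset : ((sqTriplesE m₁ m₂ m₃ m₄ L).filter fun r : ℕ × ℕ × ℕ => r.1 = a) =
        ({a} : Finset ℕ) ×ˢ triPairsE (a + m₂) m₃ m₄ L := by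
      ext ⟨r₁, r₂, r₃⟩
      simp only [sqTriplesE, triPairsE, Finset.mem_filter, Finset.mem_product, Finset.mem_Icc,
        Finset.mem_singleton]
      constructor <;> (intro hh; omega)
    rw [hset, Finset.card_product, Finset.card_singleton, one_mul, card_triPairsE_eq_choose (by omega)]
    (congr 1; omega)
  rw [Finset.sum_congr rfl hfib, sum_Icc_choose_two_reflect]
  (congr 1; omega)

/-- The same in the PRINTED product form: `6·#sqTriplesE(L) = (L+1−m_{1,4})(L+2−m_{1,4})(L+3−m_{1,4})`, i.e. the
coefficient of `a_L(x) μ̄^L` in (5.42) is `(1/6)∏_{s=1}^{3}(L−m_{1,4}+s)` exactly as printed.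
[cite: FitznerVanDerHofstad2016NoBLE, §5.3.2 (5.42) PTRF p. 1098] -/
theorem six_mul_card_sqTriplesE_eq_prod {m₁ m₂ m₃ m₄ L : ℕ} (h : m₁ + m₂ + m₃ + m₄ ≤ L) :
    6 * (sqTriplesE m₁ m₂ m₃ m₄ L).card =
      (L + 1 - (m₁ + m₂ + m₃ + m₄)) * (L + 2 - (m₁ + m₂ + m₃ + m₄)) * (L + 3 - (m₁ + m₂ + m₃ + m₄)) := by
  rw [card_sqTriplesE_eq_choose h, show L + 3 - (m₁ + m₂ + m₃ + m₄) = (L - (m₁ + m₂ + m₃ + m₄)) + 3 by omega,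
    show L + 2 - (m₁ + m₂ + m₃ + m₄) = (L - (m₁ + m₂ + m₃ + m₄)) + 2 by omega,
    show L + 1 - (m₁ + m₂ + m₃ + m₄) = (L - (m₁ + m₂ + m₃ + m₄)) + 1 by omega]
  exact (mul_choose_two_three_eq_prod _).2

/-- **Square, one-tail term**: `#sqTriplesO(M) = C(M + 2 − m_{1,4}, 3)` (truncated subtraction; `0` when
`m_{1,4} ≥ M`) — the number of positions `m₁ ≤ r₁`, `r₁+m₂ ≤ r₂`, `r₂+m₃ ≤ r₃ ≤ M−m₄−1` of three explicit pieces
followed by one tail, i.e. the coefficient of `(2dμ̄)^M (D^{⋆M}⋆G)(x)` that the extraction argument of p. 1098 yields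
for the square; the display (5.42) prints the larger `(1/6)∏_{s=1}^{3}(M−m_{1,4}+s) = C(M+3−m_{1,4},3)` there
(`card_sqTriplesO_le_printed`).  Proof: the fibre over `r₁ = a` is `{a} × triPairsO (a+m₂) m₃ m₄ M`.
[cite: FitznerVanDerHofstad2016NoBLE, §5.3.2 (5.42) PTRF p. 1098] -/
theorem card_sqTriplesO_eq_choose (m₁ m₂ m₃ m₄ M : ℕ) :
    (sqTriplesO m₁ m₂ m₃ m₄ M).card = (M + 2 - (m₁ + m₂ + m₃ + m₄)).choose 3 := by
  classical
  have hmaps : ((sqTriplesO m₁ m₂ m₃ m₄ M : Finset (ℕ × ℕ × ℕ)) : Set (ℕ × ℕ × ℕ)).MapsTo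
      (fun r : ℕ × ℕ × ℕ => r.1) (Finset.Ico m₁ M : Finset ℕ) := by
    intro r hr
    have hr' : r ∈ sqTriplesO m₁ m₂ m₃ m₄ M := by simpa using hr
    simp only [sqTriplesO, Finset.mem_filter, Finset.mem_product] at hr'
    simpa using hr'.1.1
  rw [Finset.card_eq_sum_card_fiberwise hmaps]
  have hfib : ∀ a ∈ Finset.Ico m₁ M,
      ((sqTriplesO m₁ m₂ m₃ m₄ M).filter fun r : ℕ × ℕ × ℕ => r.1 = a).card =
        (M + 1 - (m₂ + m₃ + m₄) - a).choose 2 := by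
    intro a ha
    rw [Finset.mem_Ico] at ha
    have hset : ((sqTriplesO m₁ m₂ m₃ m₄ M).filter fun r : ℕ × ℕ × ℕ => r.1 = a) =
        ({a} : Finset ℕ) ×ˢ triPairsO (a + m₂) m₃ m₄ M := by
      ext ⟨r₁, r₂, r₃⟩
      simp only [sqTriplesO, triPairsO, Finset.mem_filter, Finset.mem_product, Finset.mem_Ico,
        Finset.mem_singleton]
      constructor <;> (intro hh; omega)
    rw [hset, Finset.card_product, Finset.card_singleton, one_mul, card_triPairsO_eq_choose]
    (congr 1; omega)
  rw [Finset.sum_congr rfl hfib, sum_Ico_choose_two_of_le m₁ (M + 1 - (m₂ + m₃ + m₄)) M (by omega)]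
  rcases Nat.lt_or_ge (M + 1) (m₂ + m₃ + m₄) with hM | hM
  · rw [Nat.choose_eq_zero_of_lt (by omega), Nat.choose_eq_zero_of_lt (by omega)]
  · (congr 1; omega)

/-- The printed one-tail square coefficient is a valid OVER-count: `#sqTriplesO(M) ≤ C(M+3−m_{1,4}, 3)`
`= (1/6)∏_{s=1}^{3}(M−m_{1,4}+s)`. [cite: FitznerVanDerHofstad2016NoBLE, §5.3.2 (5.42) PTRF p. 1098] -/
theorem card_sqTriplesO_le_printed (m₁ m₂ m₃ m₄ M : ℕ) :
    (sqTriplesO m₁ m₂ m₃ m₄ M).card ≤ (M + 3 - (m₁ + m₂ + m₃ + m₄)).choose 3 := by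
  rw [card_sqTriplesO_eq_choose]
  exact Nat.choose_le_choose 3 (by omega)

/-- … and it exceeds the count by exactly `C(M+2−m_{1,4}, 2)` (truncated subtraction, every `m₁, …, m₄, M`):
`C(M+3−m,3) = #sqTriplesO(M) + C(M+2−m,2)`. [cite: FitznerVanDerHofstad2016NoBLE, §5.3.2 (5.42) PTRF p. 1098] -/
theorem printed_eq_card_sqTriplesO_add (m₁ m₂ m₃ m₄ M : ℕ) :
    (M + 3 - (m₁ + m₂ + m₃ + m₄)).choose 3 =
      (sqTriplesO m₁ m₂ m₃ m₄ M).card + (M + 2 - (m₁ + m₂ + m₃ + m₄)).choose 2 := by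
  rw [card_sqTriplesO_eq_choose]
  rcases Nat.lt_or_ge M (m₁ + m₂ + m₃ + m₄) with h | h
  · have h1 : (M + 3 - (m₁ + m₂ + m₃ + m₄)).choose 3 = 0 := Nat.choose_eq_zero_of_lt (by omega)
    have h2 : (M + 2 - (m₁ + m₂ + m₃ + m₄)).choose 3 = 0 := Nat.choose_eq_zero_of_lt (by omega)
    have h3 : (M + 2 - (m₁ + m₂ + m₃ + m₄)).choose 2 = 0 := Nat.choose_eq_zero_of_lt (by omega)
    simp only [h1, h2, h3, Nat.add_zero]
  · rw [show M + 3 - (m₁ + m₂ + m₃ + m₄) = (M - (m₁ + m₂ + m₃ + m₄)) + 3 by omega,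
      show M + 2 - (m₁ + m₂ + m₃ + m₄) = (M - (m₁ + m₂ + m₃ + m₄)) + 2 by omega, (choose_succ_two_three _).2]

/-- The one-tail square count against the PRINTED product form: `6·#sqTriplesO(M) ≤ ∏_{s=1}^{3}(M−m_{1,4}+s)` (every
`m₁,…,m₄, M`; for `m_{1,4} ≤ M` the difference is `3(M+1−m_{1,4})(M+2−m_{1,4})`).
[cite: FitznerVanDerHofstad2016NoBLE, §5.3.2 (5.42) PTRF p. 1098] -/
theorem six_mul_card_sqTriplesO_le_prod (m₁ m₂ m₃ m₄ M : ℕ) :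
    6 * (sqTriplesO m₁ m₂ m₃ m₄ M).card ≤
      (M + 1 - (m₁ + m₂ + m₃ + m₄)) * (M + 2 - (m₁ + m₂ + m₃ + m₄)) * (M + 3 - (m₁ + m₂ + m₃ + m₄)) := by
  rcases Nat.lt_or_ge M (m₁ + m₂ + m₃ + m₄) with h | h
  · rw [card_sqTriplesO_eq_choose, Nat.choose_eq_zero_of_lt (by omega)]
    exact Nat.zero_le _
  · calc 6 * (sqTriplesO m₁ m₂ m₃ m₄ M).card ≤ 6 * (M + 3 - (m₁ + m₂ + m₃ + m₄)).choose 3 :=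
          Nat.mul_le_mul_left 6 (card_sqTriplesO_le_printed m₁ m₂ m₃ m₄ M)
      _ = (M + 1 - (m₁ + m₂ + m₃ + m₄)) * (M + 2 - (m₁ + m₂ + m₃ + m₄)) * (M + 3 - (m₁ + m₂ + m₃ + m₄)) := by
          rw [show M + 3 - (m₁ + m₂ + m₃ + m₄) = (M - (m₁ + m₂ + m₃ + m₄)) + 3 by omega,
            show M + 2 - (m₁ + m₂ + m₃ + m₄) = (M - (m₁ + m₂ + m₃ + m₄)) + 2 by omega,
            show M + 1 - (m₁ + m₂ + m₃ + m₄) = (M - (m₁ + m₂ + m₃ + m₄)) + 1 by omega]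
          exact (mul_choose_two_three_eq_prod _).2

/-- **Square, two-tail term**: `#triPairsO m₁ m₂ m₃ (M − m₄) = C(M + 1 − m_{1,4}, 2) = ½(M−m_{1,4})(M+1−m_{1,4})`
— the number of positions `m₁ ≤ r₁`, `r₁+m₂ ≤ r₂ ≤ M−m₃−m₄−1` of two explicit pieces followed by two tails, i.e.
the coefficient of `(2dμ̄)^M (D^{⋆M}⋆G^{⋆2})(x)` that the extraction argument yields; (5.42) prints
`½(M−m_{1,4})(M−1−m_{1,4}) = C(M−m_{1,4},2)` there, smaller by `M − m_{1,4}` (`card_sqTwoTail_eq_printed_add`).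
[cite: FitznerVanDerHofstad2016NoBLE, §5.3.2 (5.42) PTRF p. 1098] -/
theorem card_sqTwoTail_eq_choose (m₁ m₂ m₃ m₄ M : ℕ) :
    (triPairsO m₁ m₂ m₃ (M - m₄)).card = (M + 1 - (m₁ + m₂ + m₃ + m₄)).choose 2 := by
  rw [card_triPairsO_eq_choose]
  rcases Nat.lt_or_ge M m₄ with h | h
  · rw [Nat.choose_eq_zero_of_lt (by omega), Nat.choose_eq_zero_of_lt (by omega)]
  · (congr 1; omega)

/-- The two-tail square count against the printed closed form (truncated subtraction, every `m₁, …, m₄, M`):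
`#triPairsO m₁ m₂ m₃ (M−m₄) = C(M−m_{1,4}, 2) + (M − m_{1,4})`. [cite: FitznerVanDerHofstad2016NoBLE, §5.3.2 (5.42) PTRF p. 1098] -/
theorem card_sqTwoTail_eq_printed_add (m₁ m₂ m₃ m₄ M : ℕ) :
    (triPairsO m₁ m₂ m₃ (M - m₄)).card =
      (M - (m₁ + m₂ + m₃ + m₄)).choose 2 + (M - (m₁ + m₂ + m₃ + m₄)) := by
  rw [card_sqTwoTail_eq_choose]
  rcases Nat.lt_or_ge M (m₁ + m₂ + m₃ + m₄) with h | h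
  · have h1 : (M + 1 - (m₁ + m₂ + m₃ + m₄)).choose 2 = 0 := Nat.choose_eq_zero_of_lt (by omega)
    have h2 : (M - (m₁ + m₂ + m₃ + m₄)).choose 2 = 0 := Nat.choose_eq_zero_of_lt (by omega)
    rw [h1, h2]
    omega
  · rw [show M + 1 - (m₁ + m₂ + m₃ + m₄) = (M - (m₁ + m₂ + m₃ + m₄)) + 1 by omega, (choose_succ_two_three _).1]

/-- The two-tail square count in the PRINTED product form: `2·#triPairsO m₁ m₂ m₃ (M−m₄) = (M−m_{1,4})(M+1−m_{1,4})`
(truncated subtraction); the display (5.42) prints `½(M−m_{1,4})(M−1−m_{1,4})` there.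
[cite: FitznerVanDerHofstad2016NoBLE, §5.3.2 (5.42) PTRF p. 1098] -/
theorem two_mul_card_sqTwoTail_eq_prod (m₁ m₂ m₃ m₄ M : ℕ) :
    2 * (triPairsO m₁ m₂ m₃ (M - m₄)).card =
      (M - (m₁ + m₂ + m₃ + m₄)) * (M + 1 - (m₁ + m₂ + m₃ + m₄)) := by
  rcases Nat.lt_or_ge (m₁ + m₂ + m₃ + m₄) M with h' | h'
  · rw [card_sqTwoTail_eq_choose]
    obtain ⟨n, rfl⟩ : ∃ n, M = m₁ + m₂ + m₃ + m₄ + 1 + n := ⟨M - (m₁ + m₂ + m₃ + m₄) - 1, by omega⟩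
    rw [show m₁ + m₂ + m₃ + m₄ + 1 + n + 1 - (m₁ + m₂ + m₃ + m₄) = n + 2 by omega,
      show m₁ + m₂ + m₃ + m₄ + 1 + n - (m₁ + m₂ + m₃ + m₄) = n + 1 by omega]
    exact (mul_choose_two_three_eq_prod n).1
  · rw [card_sqTwoTail_eq_choose, Nat.choose_eq_zero_of_lt (by omega),
      show M - (m₁ + m₂ + m₃ + m₄) = 0 by omega]
    simp

/-- **Square, three-tail term**: `#Ico m₁ (M − m₂ − m₃ − m₄) = M − m_{1,4}` — the printed coefficient `(M−m_{1,4})`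
of `(2dμ̄)^M (D^{⋆M}⋆G^{⋆3})(x)` in (5.42). [cite: FitznerVanDerHofstad2016NoBLE, §5.3.2 (5.42) PTRF p. 1098] -/
theorem card_sqThreeTail_eq (m₁ m₂ m₃ m₄ M : ℕ) :
    (Finset.Ico m₁ (M - (m₂ + m₃ + m₄))).card = M - (m₁ + m₂ + m₃ + m₄) := by
  rw [Nat.card_Ico]
  omega

/-- The instance quoted in the packet (HOME D27/D57; `m₁ = ⋯ = m₄ = 1`, `M = 6`, `n = 2`): one-tail count
`C(4,3) = 4` (printed `C(5,3) = 10`), two-tail count `C(3,2) = 3` (printed `C(2,2) = 1`), three-tail `2`.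
[folklore] -/
example : (sqTriplesO 1 1 1 1 6).card = 4 ∧ (triPairsO 1 1 1 (6 - 1)).card = 3 ∧
    (Finset.Ico 1 (6 - (1 + 1 + 1))).card = 2 := by
  refine ⟨?_, ?_, ?_⟩
  · rw [card_sqTriplesO_eq_choose]; rfl
  · rw [card_sqTwoTail_eq_choose]; rfl
  · simp

/-! ### D. (5.41) and (5.42) with binomial multiplicities -/

/-- **[NoBLE17] (5.41) with every multiplicity a binomial coefficient** (summed over finite sets of sites
`v ∈ S₁`, `y ∈ S₂`; every `m₁, m₂, m₃, M, x, p`):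
`Σ_{v,y} 𝓣(v,y,x) ≤ Σ_{L=m_{1,3}}^{M−1} C(L+2−m_{1,3},2)·a_L(x)·p^L + C(M+1−m_{1,3},2)·p^M Σ_{u∈M-trails} τ_p(x−u(M))`
` + (M−m_{1,3})·[two-tail word sum] + [three-tail word sum]` — the printed display with the one-tail coefficient in
its first printed form `Σ_s (M−m_{2,3}−s) = ½(M−m_{1,3})(M+1−m_{1,3})`.
[cite: FitznerVanDerHofstad2016NoBLE, §5.3.2 (5.41) PTRF p. 1098] -/
theorem sum_sum_diagT_le_extraction_choose (p : unitInterval) (m₁ m₂ m₃ M : ℕ) (x : Site d)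
    (S₁ S₂ : Finset (Site d)) :
    ∑ v ∈ S₁, ∑ y ∈ S₂, diagT d p m₁ m₂ m₃ v y x ≤
      (∑ L ∈ Finset.Ico (m₁ + m₂ + m₃) M,
          (((L + 2 - (m₁ + m₂ + m₃)).choose 2 : ℕ) : ℝ) * ((trailWordsTo d L x).card : ℝ) * (p : ℝ) ^ L) +
        (((M + 1 - (m₁ + m₂ + m₃)).choose 2 : ℕ) : ℝ) *
            ((p : ℝ) ^ M * ∑ u ∈ trailWords d M, tau d p 0 (x - wordPos u M)) +
          ((M - (m₁ + m₂ + m₃) : ℕ) : ℝ) * ((p : ℝ) ^ (M - m₃) * (p : ℝ) ^ m₃ *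
            ∑ uu ∈ idxTwoTail (d := d) m₃ M,
              ∑ y ∈ S₂, tau d p (wordPos uu.1 (M - m₃)) y * tau d p (y + wordPos uu.2 m₃) x) +
            (p : ℝ) ^ (M - (m₂ + m₃)) * (p : ℝ) ^ m₂ * (p : ℝ) ^ m₃ *
              ∑ t ∈ idxThreeTailT (d := d) m₂ m₃ M, ∑ v ∈ S₁, ∑ y ∈ S₂,
                tau d p (wordPos t.1 (M - (m₂ + m₃))) v * tau d p (v + wordPos t.2.1 m₂) y *
                  tau d p (y + wordPos t.2.2 m₃) x := by
  have h := sum_sum_diagT_le_extraction p m₁ m₂ m₃ M x S₁ S₂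
  have hE : (∑ L ∈ Finset.Ico (m₁ + m₂ + m₃) M,
      ((triPairsE m₁ m₂ m₃ L).card : ℝ) * ((trailWordsTo d L x).card : ℝ) * (p : ℝ) ^ L) =
      ∑ L ∈ Finset.Ico (m₁ + m₂ + m₃) M,
        (((L + 2 - (m₁ + m₂ + m₃)).choose 2 : ℕ) : ℝ) * ((trailWordsTo d L x).card : ℝ) * (p : ℝ) ^ L :=
    Finset.sum_congr rfl fun L hL => by rw [card_triPairsE_eq_choose (Finset.mem_Ico.1 hL).1]
  rw [hE, card_triPairsO_eq_choose, card_triTwoTail_eq] at h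
  exact h

/-- **[NoBLE17] (5.42) with every multiplicity a binomial coefficient** (summed over finite sets of sites
`v ∈ S₁`, `y ∈ S₂`, `w ∈ S₃`; every `m₁, …, m₄, M, x, p`): explicit `C(L+3−m_{1,4},3) = (1/6)∏_{s=1}^{3}(L−m_{1,4}+s)`,
one-tail `C(M+2−m_{1,4},3)`, two-tail `C(M+1−m_{1,4},2)`, three-tail `M−m_{1,4}`, four-tail `1`.
[cite: FitznerVanDerHofstad2016NoBLE, §5.3.2 (5.42) PTRF p. 1098] -/
theorem sum3_diagS_le_extraction_choose (p : unitInterval) (m₁ m₂ m₃ m₄ M : ℕ) (x : Site d)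
    (S₁ S₂ S₃ : Finset (Site d)) :
    ∑ v ∈ S₁, ∑ y ∈ S₂, ∑ w ∈ S₃, diagS d p m₁ m₂ m₃ m₄ v y w x ≤
      (∑ L ∈ Finset.Ico (m₁ + m₂ + m₃ + m₄) M,
          (((L + 3 - (m₁ + m₂ + m₃ + m₄)).choose 3 : ℕ) : ℝ) * ((trailWordsTo d L x).card : ℝ) * (p : ℝ) ^ L) +
        (((M + 2 - (m₁ + m₂ + m₃ + m₄)).choose 3 : ℕ) : ℝ) *
            ((p : ℝ) ^ M * ∑ u ∈ trailWords d M, tau d p 0 (x - wordPos u M)) +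
          (((M + 1 - (m₁ + m₂ + m₃ + m₄)).choose 2 : ℕ) : ℝ) * ((p : ℝ) ^ (M - m₄) * (p : ℝ) ^ m₄ *
            ∑ uu ∈ idxTwoTail (d := d) m₄ M,
              ∑ w ∈ S₃, tau d p (wordPos uu.1 (M - m₄)) w * tau d p (w + wordPos uu.2 m₄) x) +
            ((M - (m₁ + m₂ + m₃ + m₄) : ℕ) : ℝ) *
              ((p : ℝ) ^ (M - (m₃ + m₄)) * (p : ℝ) ^ m₃ * (p : ℝ) ^ m₄ *
                ∑ t ∈ idxThreeTailT (d := d) m₃ m₄ M, ∑ y ∈ S₂, ∑ w ∈ S₃,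
                  tau d p (wordPos t.1 (M - (m₃ + m₄))) y * tau d p (y + wordPos t.2.1 m₃) w *
                    tau d p (w + wordPos t.2.2 m₄) x) +
              (p : ℝ) ^ (M - (m₂ + m₃ + m₄)) * (p : ℝ) ^ m₂ * (p : ℝ) ^ m₃ * (p : ℝ) ^ m₄ *
                ∑ t ∈ idxFourTailS (d := d) m₂ m₃ m₄ M, ∑ v ∈ S₁, ∑ y ∈ S₂, ∑ w ∈ S₃,
                  tau d p (wordPos t.1 (M - (m₂ + m₃ + m₄))) v * tau d p (v + wordPos t.2.1 m₂) y *
                    tau d p (y + wordPos t.2.2.1 m₃) w * tau d p (w + wordPos t.2.2.2 m₄) x := by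
  have h := sum3_diagS_le_extraction p m₁ m₂ m₃ m₄ M x S₁ S₂ S₃
  have hE : (∑ L ∈ Finset.Ico (m₁ + m₂ + m₃ + m₄) M,
      ((sqTriplesE m₁ m₂ m₃ m₄ L).card : ℝ) * ((trailWordsTo d L x).card : ℝ) * (p : ℝ) ^ L) =
      ∑ L ∈ Finset.Ico (m₁ + m₂ + m₃ + m₄) M,
        (((L + 3 - (m₁ + m₂ + m₃ + m₄)).choose 3 : ℕ) : ℝ) * ((trailWordsTo d L x).card : ℝ) * (p : ℝ) ^ L :=
    Finset.sum_congr rfl fun L hL => by rw [card_sqTriplesE_eq_choose (Finset.mem_Ico.1 hL).1]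
  rw [hE, card_sqTriplesO_eq_choose, card_sqTwoTail_eq_choose, card_sqThreeTail_eq] at h
  exact h

/-- **[NoBLE17] (5.42) in the printed shape, with the one correction the extraction argument forces**: the printed
one-tail coefficient `(1/6)∏_{s=1}^{3}(M−m_{1,4}+s) = C(M+3−m_{1,4},3)` is kept (it exceeds the count
`C(M+2−m_{1,4},3)` and the one-tail word sum is `≥ 0`), the two-tail coefficient is `C(M+1−m_{1,4},2) =
½(M−m_{1,4})(M+1−m_{1,4})` (the printed `½(M−m_{1,4})(M−1−m_{1,4})` is not what the derivation gives — HOME D57),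
explicit `(1/6)∏_{s=1}^{3}(L−m_{1,4}+s)`, three-tail `(M−m_{1,4})`, four-tail `1` as printed.
[cite: FitznerVanDerHofstad2016NoBLE, §5.3.2 (5.42) PTRF p. 1098] -/
theorem sum3_diagS_le_extraction_printedShape (p : unitInterval) (m₁ m₂ m₃ m₄ M : ℕ) (x : Site d)
    (S₁ S₂ S₃ : Finset (Site d)) :
    ∑ v ∈ S₁, ∑ y ∈ S₂, ∑ w ∈ S₃, diagS d p m₁ m₂ m₃ m₄ v y w x ≤
      (∑ L ∈ Finset.Ico (m₁ + m₂ + m₃ + m₄) M,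
          (((L + 3 - (m₁ + m₂ + m₃ + m₄)).choose 3 : ℕ) : ℝ) * ((trailWordsTo d L x).card : ℝ) * (p : ℝ) ^ L) +
        (((M + 3 - (m₁ + m₂ + m₃ + m₄)).choose 3 : ℕ) : ℝ) *
            ((p : ℝ) ^ M * ∑ u ∈ trailWords d M, tau d p 0 (x - wordPos u M)) +
          (((M + 1 - (m₁ + m₂ + m₃ + m₄)).choose 2 : ℕ) : ℝ) * ((p : ℝ) ^ (M - m₄) * (p : ℝ) ^ m₄ *
            ∑ uu ∈ idxTwoTail (d := d) m₄ M,
              ∑ w ∈ S₃, tau d p (wordPos uu.1 (M - m₄)) w * tau d p (w + wordPos uu.2 m₄) x) +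
            ((M - (m₁ + m₂ + m₃ + m₄) : ℕ) : ℝ) *
              ((p : ℝ) ^ (M - (m₃ + m₄)) * (p : ℝ) ^ m₃ * (p : ℝ) ^ m₄ *
                ∑ t ∈ idxThreeTailT (d := d) m₃ m₄ M, ∑ y ∈ S₂, ∑ w ∈ S₃,
                  tau d p (wordPos t.1 (M - (m₃ + m₄))) y * tau d p (y + wordPos t.2.1 m₃) w *
                    tau d p (w + wordPos t.2.2 m₄) x) +
              (p : ℝ) ^ (M - (m₂ + m₃ + m₄)) * (p : ℝ) ^ m₂ * (p : ℝ) ^ m₃ * (p : ℝ) ^ m₄ *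
                ∑ t ∈ idxFourTailS (d := d) m₂ m₃ m₄ M, ∑ v ∈ S₁, ∑ y ∈ S₂, ∑ w ∈ S₃,
                  tau d p (wordPos t.1 (M - (m₂ + m₃ + m₄))) v * tau d p (v + wordPos t.2.1 m₂) y *
                    tau d p (y + wordPos t.2.2.1 m₃) w * tau d p (w + wordPos t.2.2.2 m₄) x := by
  have hT : (0 : ℝ) ≤ (p : ℝ) ^ M * ∑ u ∈ trailWords d M, tau d p 0 (x - wordPos u M) :=
    mul_nonneg (pow_nonneg p.2.1 _) (Finset.sum_nonneg fun u _ => tau_nonneg p _ _)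
  have hC : (((M + 2 - (m₁ + m₂ + m₃ + m₄)).choose 3 : ℕ) : ℝ) ≤
      (((M + 3 - (m₁ + m₂ + m₃ + m₄)).choose 3 : ℕ) : ℝ) := by
    exact_mod_cast Nat.choose_le_choose 3 (by omega)
  have hO := mul_le_mul_of_nonneg_right hC hT
  linarith [hO, sum3_diagS_le_extraction_choose p m₁ m₂ m₃ m₄ M x S₁ S₂ S₃]

end Literature.Probability.FitznerVanDerHofstad2017

end
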